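import Summits.BirchSwinnertonDyer.BirchSwinnertonDyer.Theorems.CumulativeHeegnerLeopoldtCumulativeHeegnerInclusionAtThreeStubResidualSelmerFiniteDevissageNamed
import HarnessLib

/-!
# The residual row `U(N₁) → U(N₂) → U(N₃)` at the `U`-level is EXACT IN THE MIDDLE (classes of `H¹(K_∞, ·)`
# unramified outside `S₀ ∪ {p}`), and so is the local row `H¹(G_j, N₁) → H¹(G_j, N₂) → H¹(G_j, N₃)`
# (cell `bsd-eis`, seat `bsd-line-x1-p1-w4` gen 3, D-0154 WIDTH PASS; crux 2 `GoodLatticeBDPValue`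
# stmt-BirchSwinnertonDyer-19032, line `halves` v19.1, V21 INDEX ROAD step (3): the residual long exact sequences
# `X_ω → X_f → X_1`, `Y_ω → Y_f → Y_1 → 0` of LEAD g4's `FiniteIndexCalculus.zpCorank_add_eq_of_index_inputs`)

HONEST FRAMING (cell `bsd-eis`, run/shared/lean/pub/bsd-eis/): Galois-cohomology bookkeeping for ABSTRACT
discrete `Γ_K`-modules; no definition, no named fact, no `sorry`, no `Theses` import; nothing about any curve is
asserted; BSD / IMC2 / KY Thm. 1.4.1 are proved for NO curve. Helper `--supports stmt-BirchSwinnertonDyer-19032`.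

## What
For an exact sequence `0 → N₁ —j→ N₂ —q→ N₃ → 0` of discrete `Γ_K`-modules (continuous orbits on `N₂`), a
subgroup `H ≤ Γ_K` and a set of places `S₀`:
* `range_resH1Hom_id_eq_ker` — at the `H¹(G, ·)`-level for ANY topological group: `range j_* = ker q_*`
  (`⊆`: `q ∘ j = 0`; `⊇`: the tree's `exists_resH1Hom_eq_of_resH1Hom_eq_zero`, explicit cocycles). This is the
  LOCAL row `Y_ω → Y_f → Y_1` at `G = ker κ ⊓ D_v̄` (with `→ 0` = LRS_loc, p642632).
* `exists_mem_unramifiedOutside_resH1Hom_id_eq` / `range_eq_ker_unramifiedOutside` — at the `U`-level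
  `U(·) = unramifiedOutside H · p S₀`: a class of `U(N₂)` killed by `q_*` is `j_*` of a class of `U(N₁)`, provided
  `j_*` is injective on the inertia cohomology `H¹(H ⊓ I_w, ·)` at every `w ∉ S₀`, `w ∤ p` (hypothesis (U); for
  the road: `I_w` acts TRIVIALLY on `N₂ = E_K[p]` at the good `w ∉ S₀ ⊇ {bad}` — Néron–Ogg–Shafarevich — and then
  (U) is the tree's `resH1Hom_id_injective_of_smul_eq`, packaged as `…_of_inertia_trivial`). This is the GLOBAL
  row `X_ω → X_f → X_1`.

References: [SerreGaloisCohomology1997] I.§2.2 (Prop. 2); [KellerYin2024] proof of Thm. 1.4.1, the rows of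
(SelfSelomega) (arXiv:2402.12781v2 TeX L1183–1200); [GreenbergVatsal2000] §2 pp. 16–17 (`H¹(ℚ_Σ/ℚ_∞, ·)`).
-/

set_option autoImplicit false
set_option linter.dupNamespace false -- the summit namespace `…BirchSwinnertonDyer.BirchSwinnertonDyer.Theorems` (Sub = Summit, D-0017) trips it

noncomputable section

open scoped Classical

universe u

namespace Summit.BirchSwinnertonDyer.BirchSwinnertonDyer.Theorems.H1KernelFixedPointCount

open NumberField IsDedekindDomain Field
open Literature.NumberTheory.EllipticCurves Literature.NumberTheory.EllipticCurves.GreenbergSelmer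
  Literature.NumberTheory.EllipticCurves.GreenbergVatsal2000 Literature.NumberTheory.GaloisRepresentations
  Literature.NumberTheory.EllipticCurves.FineSelmerCoefficientMap
  Summit.BirchSwinnertonDyer.BirchSwinnertonDyer.Theorems.CumulativeHeegnerInclusionAtThreeStubB1Devissage
  Summit.BirchSwinnertonDyer.BirchSwinnertonDyer.Theorems.CumulativeHeegnerInclusionAtThreeStubB1DevissageNamed
  Summit.BirchSwinnertonDyer.BirchSwinnertonDyer.Theorems.UniversalToricDescentResidualSelmer

/-! ### §1 The `H¹(G, ·)`-level: `range j_* = ker q_*` -/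

section Generic

variable {G : Type u} [Group G] [TopologicalSpace G] [IsTopologicalGroup G]
variable {A : Type u} [AddCommGroup A] [DistribMulAction G A] [TopologicalSpace A] [DiscreteTopology A]
variable {B : Type u} [AddCommGroup B] [DistribMulAction G B] [TopologicalSpace B] [DiscreteTopology B]
variable {C : Type u} [AddCommGroup C] [DistribMulAction G C] [TopologicalSpace C] [DiscreteTopology C]

/-- **`range(j_*) = ker(q_*)` on `H¹(G, ·)`** for an exact `0 → A —j→ B —q→ C → 0` of discrete `G`-modules
(continuous orbits on `B`): `q_* ∘ j_* = (q ∘ j)_* = 0`, and a class killed by `q_*` comes from `A`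
(tree `exists_resH1Hom_eq_of_resH1Hom_eq_zero`). [cite: SerreGaloisCohomology1997, I.§2.2 (Prop. 2)] -/
theorem range_resH1Hom_id_eq_ker (j : A →+ B)
    (hj : ∀ (g : G) (a : A), j (ContinuousMonoidHom.id G g • a) = g • j a) (hinj : Function.Injective j)
    (q : B →+ C) (hq : ∀ (g : G) (b : B), q (ContinuousMonoidHom.id G g • b) = g • q b)
    (hqj : ∀ a : A, q (j a) = 0) (hexact : ∀ b : B, q b = 0 → ∃ a : A, j a = b)
    (hsurj : Function.Surjective q) (hcont : ∀ b : B, Continuous fun g : G ↦ g • b) :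
    (resH1Hom (ContinuousMonoidHom.id G) j hj).range = (resH1Hom (ContinuousMonoidHom.id G) q hq).ker := by
  ext y
  rw [AddMonoidHom.mem_range, AddMonoidHom.mem_ker]
  constructor
  · rintro ⟨x, rfl⟩
    obtain ⟨φ, rfl⟩ := oneCocycleClass_surjective _ x
    rw [resH1Hom_id_oneCocycleClass, resH1Hom_id_oneCocycleClass]
    refine (oneCocycleClass_eq_zero_iff _ _).mpr ⟨0, fun g ↦ ?_⟩
    change q (j (φ.1 g)) = (discreteTopRep G C).ρ g (0 : C) - 0
    rw [hqj, map_zero, sub_zero]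
  · intro hy
    exact exists_resH1Hom_eq_of_resH1Hom_eq_zero j hj hinj q hq hsurj hexact hcont hy

end Generic

/-! ### §2 The `U`-level over `K_∞`: classes unramified outside `S₀ ∪ {p}` -/

section Unramified

variable {K : Type} [Field K] [NumberField K] {p : ℕ} (H : Subgroup (absoluteGaloisGroup K)) [H.Normal]
  (S₀ : Set (HeightOneSpectrum (𝓞 K)))
  {A : Type} [AddCommGroup A] [DistribMulAction (absoluteGaloisGroup K) A] [TopologicalSpace A]
  [DiscreteTopology A]
  {B : Type} [AddCommGroup B] [DistribMulAction (absoluteGaloisGroup K) B] [TopologicalSpace B]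
  [DiscreteTopology B]
  {C : Type} [AddCommGroup C] [DistribMulAction (absoluteGaloisGroup K) C] [TopologicalSpace C]
  [DiscreteTopology C]

/-- **Middle exactness at the `U`-level**: a class `y ∈ unramifiedOutside H B p S₀` killed by `q_*` is `j_* x`
for some `x ∈ unramifiedOutside H A p S₀`, provided (U) `j_*` is injective on `H¹(H ⊓ I_w, ·)` at every
`w ∉ S₀`, `w ∤ p` (the lift `x` given by middle exactness on `H¹(H, ·)` is unramified where `y` is: `j_*`
commutes with conjugation and with restriction to inertia, and (U) reflects the vanishing).
[cite: SerreGaloisCohomology1997, I.§2.2 (Prop. 2)] [cite: GreenbergVatsal2000, §2 pp. 16–17] -/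
theorem exists_mem_unramifiedOutside_resH1Hom_id_eq (j : A →+ B)
    (hj : ∀ (σ : absoluteGaloisGroup K) (a : A), j (σ • a) = σ • j a) (hinj : Function.Injective j)
    (q : B →+ C) (hq : ∀ (σ : absoluteGaloisGroup K) (b : B), q (σ • b) = σ • q b)
    (hexact : ∀ b : B, q b = 0 → ∃ a : A, j a = b) (hsurj : Function.Surjective q)
    (hcont : ∀ b : B, Continuous fun g : absoluteGaloisGroup K ↦ g • b)
    (hU : ∀ v : HeightOneSpectrum (𝓞 K), v ∉ S₀ → ((p : ℕ) : 𝓞 K) ∉ v.asIdeal →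
      Function.Injective (resH1Hom (ContinuousMonoidHom.id (inertiaIn H v)) j (fun _ a ↦ hj _ a)))
    {y : subgroupH1 H B} (hyU : y ∈ unramifiedOutside H B p S₀)
    (hy : resH1Hom (ContinuousMonoidHom.id H) q (fun g b ↦ hq (g : absoluteGaloisGroup K) b) y = 0) :
    ∃ x ∈ unramifiedOutside H A p S₀,
      resH1Hom (ContinuousMonoidHom.id H) j (fun g a ↦ hj (g : absoluteGaloisGroup K) a) x = y := by
  obtain ⟨x, rfl⟩ := exists_resH1Hom_eq_of_resH1Hom_eq_zero (G := H) j
    (fun g a ↦ hj (g : absoluteGaloisGroup K) a) hinj q (fun g b ↦ hq (g : absoluteGaloisGroup K) b) hsurj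
    hexact (fun b ↦ (hcont b).comp continuous_subtype_val) hy
  refine ⟨x, ?_, rfl⟩
  -- `x` is unramified wherever `j_* x` is, by (U)
  rw [mem_unramifiedOutside_iff] at hyU ⊢
  intro v hv hpv σ
  have h := hyU v hv hpv σ
  have hconj : conjH1 H B σ (resH1Hom (ContinuousMonoidHom.id H) j
      (fun g a ↦ hj (g : absoluteGaloisGroup K) a) x) =
        resH1Hom (ContinuousMonoidHom.id H) j (fun g a ↦ hj (g : absoluteGaloisGroup K) a)
          (conjH1 H A σ x) :=
    congrArg (fun f ↦ f x) (conjH1_comp_resH1Hom_id H j (fun g a ↦ hj (g : absoluteGaloisGroup K) a) hj σ)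
  rw [hconj, GreenbergVatsal2000.unramifiedKer, AddMonoidHom.mem_ker] at h
  rw [GreenbergVatsal2000.unramifiedKer, AddMonoidHom.mem_ker]
  have e := congrArg (fun f ↦ f (conjH1 H A σ x)) (res_inertiaIn_comp_resH1Hom_id H v j
    (fun g a ↦ hj (g : absoluteGaloisGroup K) a) (fun _ a ↦ hj _ a))
  simp only [AddMonoidHom.comp_apply] at e
  rw [e] at h
  exact (injective_iff_map_eq_zero _).mp (hU v hv hpv) _ h

/-- **The same with (U) discharged by «`I_w` acts trivially on `B` at every `w ∉ S₀`, `w ∤ p`»** (the curve: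
`B = E_K[p]`, `S₀ ⊇` the bad places, Néron–Ogg–Shafarevich; the characters: `S₀ ⊇` the ramified places):
then `j_*` is injective on the inertia cohomology (`resH1Hom_id_injective_of_smul_eq`).
[cite: SerreGaloisCohomology1997, I.§2.2–2.3] [cite: GreenbergVatsal2000, §2 pp. 16–17] -/
theorem exists_mem_unramifiedOutside_resH1Hom_id_eq_of_inertia_trivial (j : A →+ B)
    (hj : ∀ (σ : absoluteGaloisGroup K) (a : A), j (σ • a) = σ • j a) (hinj : Function.Injective j)
    (q : B →+ C) (hq : ∀ (σ : absoluteGaloisGroup K) (b : B), q (σ • b) = σ • q b)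
    (hexact : ∀ b : B, q b = 0 → ∃ a : A, j a = b) (hsurj : Function.Surjective q)
    (hcont : ∀ b : B, Continuous fun g : absoluteGaloisGroup K ↦ g • b)
    (htriv : ∀ v : HeightOneSpectrum (𝓞 K), v ∉ S₀ → ((p : ℕ) : 𝓞 K) ∉ v.asIdeal →
      ∀ g : absoluteGaloisGroup K, g ∈ inertia v → ∀ b : B, g • b = b)
    {y : subgroupH1 H B} (hyU : y ∈ unramifiedOutside H B p S₀)
    (hy : resH1Hom (ContinuousMonoidHom.id H) q (fun g b ↦ hq (g : absoluteGaloisGroup K) b) y = 0) :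
    ∃ x ∈ unramifiedOutside H A p S₀,
      resH1Hom (ContinuousMonoidHom.id H) j (fun g a ↦ hj (g : absoluteGaloisGroup K) a) x = y := by
  refine exists_mem_unramifiedOutside_resH1Hom_id_eq H S₀ j hj hinj q hq hexact hsurj hcont ?_ hyU hy
  intro v hv hpv
  exact resH1Hom_id_injective_of_smul_eq (G := ↥(inertiaIn H v)) j (fun _ a ↦ hj _ a) hinj
    (fun g b ↦ htriv v hv hpv _ ((mem_inertiaIn_iff H v _).1 g.2).2 b)

end Unramified

end Summit.BirchSwinnertonDyer.BirchSwinnertonDyer.Theorems.H1KernelFixedPointCount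

end
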